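import Mathlib.AlgebraicGeometry.Fiber
import Mathlib.AlgebraicGeometry.Stalk
import Mathlib.RingTheory.LocalRing.ResidueField.Fiber
import HarnessLib

/-!
# Local rings of scheme-theoretic fibres

For a morphism of schemes `f : X ⟶ Y`, a point `y ∈ Y` and a point `z` of the scheme-theoretic
fibre `X_y = f.fiber y` (Mathlib: `Scheme.Hom.fiber`, the pull-back `X ×_Y Spec κ(y)`) lying over
`x = f.fiberι y z ∈ X`, the local ring of the fibre is
`𝒪_{X_y, z} ≅ 𝒪_{X,x} / 𝔪_y 𝒪_{X,x}`
(Liu, *Algebraic Geometry and Arithmetic Curves*, Ch. 4, proof of Thm. 3.36: "`𝒪_{X_y,x} =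
𝒪_{X,x}/𝔪_y𝒪_{X,x}`"; Görtz–Wedhorn, *Algebraic Geometry I*, Def. 4.25 for the fibre). Mathlib has
the fibre, its affine description `Spec.fiberToSpecResidueFieldIso` (`(Spec S)_𝔭 ≅ Spec (κ(𝔭) ⊗_R S)`)
and the localisation `Ideal.Fiber.algEquivAux₂` (`(κ(𝔭) ⊗_R S)_𝔮 ≅ S_𝔯 / 𝔭 S_𝔯`), but not the
statement on stalks; this file proves it (`Literature.AlgebraicGeometry.Motives.nonempty_stalkFiber_ringEquiv`), by reduction to
the affine case along the affine covers of `Y` (base change of the fibre along an open immersion,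
`isPullback_fiberToSpecResidueField_of_isPullback`) and of `X` (open immersion of fibres).

It is used in `SubschemeCyclesProofs` to compute the multiplicities `ℓ(𝒪_{X_{f x}, x})` in the
flat pull-back of cycles (Fulton, *Intersection Theory*, §1.7).

Design: the file contains theorems only. The ring `𝒪_{X,x} / 𝔪_{f x} 𝒪_{X,x}` is written out as the
Mathlib quotient `↑(X.presheaf.stalk x) ⧸ (maximalIdeal ↑(Y.presheaf.stalk (f x))).map (f.stalkMap x).hom`
of `𝒪_{X,x}` by the extension of `𝔪_{f x}` along the stalk map `f^♯_x : 𝒪_{Y, f x} ⟶ 𝒪_{X,x}`, and the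
isomorphisms are asserted as `Nonempty (_ ≃+* _)` (only invariants of the ring, such as its
length, are used downstream).

## Main results

* `Literature.nonempty_stalkFiber_ringEquiv f y z : Nonempty (𝒪_{X_y, z} ≃+* 𝒪_{X,x} ⧸ 𝔪_y 𝒪_{X,x})`,
  `x = f.fiberι y z`; `Literature.AlgebraicGeometry.Motives.nonempty_stalkFiber_ringEquiv_asFiber` (the case `z = f.asFiber x`).
* `Literature.AlgebraicGeometry.Motives.nonempty_stalkFiber_ringEquiv_Spec`: the affine case `(κ(𝔭) ⊗_R S)_𝔮 ≅ S_𝔮 / 𝔭 S_𝔮`.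

## References

* Q. Liu, *Algebraic Geometry and Arithmetic Curves* (2002), Ch. 4, proof of Theorem 3.36.
* U. Görtz, T. Wedhorn, *Algebraic Geometry I* (2nd ed., 2020), Definition 4.25, §(4.11).
* W. Fulton, *Intersection Theory* (2nd ed., 1998), §1.7, Lemma A.4.1.
-/

universe u

open CategoryTheory AlgebraicGeometry Limits IsLocalRing TensorProduct

namespace Literature.AlgebraicGeometry.Motives

/-! ### Transport tools -/

section Tools

variable {X Y : Scheme.{u}}

/-- An isomorphism of arrows `(A ⟶ B) ≅ (A' ⟶ B')` of commutative rings with `A`, `A'` local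
induces `B ⧸ 𝔪_A B ≃+* B' ⧸ 𝔪_{A'} B'` on the fibre rings (ring isomorphisms of local rings
preserve the maximal ideal). [folklore] -/
lemma nonempty_fiberQuot_ringEquiv_of_arrowIso {A B A' B' : CommRingCat.{u}} [IsLocalRing A]
    [IsLocalRing A'] {φ : A ⟶ B} {φ' : A' ⟶ B'} (e : Arrow.mk φ ≅ Arrow.mk φ') :
    Nonempty ((↑B ⧸ (maximalIdeal ↑A).map φ.hom) ≃+* (↑B' ⧸ (maximalIdeal ↑A').map φ'.hom)) := by
  let eA : ↑A ≃+* ↑A' := (Arrow.leftFunc.mapIso e).commRingCatIsoToRingEquiv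
  let eB : ↑B ≃+* ↑B' := (Arrow.rightFunc.mapIso e).commRingCatIsoToRingEquiv
  refine ⟨Ideal.quotientEquiv _ _ eB ?_⟩
  have hw : φ'.hom.comp (eA : ↑A →+* ↑A') = (eB : ↑B →+* ↑B').comp φ.hom := by
    have := Arrow.w e.hom
    simp only [Arrow.mk_hom] at this
    exact congr(($this).hom)
  rw [← map_ringEquiv_maximalIdeal eA, ← Ideal.map_coe eA (maximalIdeal _), Ideal.map_map, hw,
    ← Ideal.map_map]

/-- For a morphism `m : F' ⟶ F` inducing an isomorphism on the stalk at `z'` (e.g. an open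
immersion or an isomorphism) and `m z' = z`, the stalks `𝒪_{F,z} ≃+* 𝒪_{F',z'}`. [folklore] -/
lemma nonempty_stalk_ringEquiv_of_isIso_stalkMap {F F' : Scheme.{u}} (m : F' ⟶ F) (z' : F') (z : F)
    (hz : m z' = z) [IsIso (m.stalkMap z')] :
    Nonempty (↑(F.presheaf.stalk z) ≃+* ↑(F'.presheaf.stalk z')) :=
  ⟨(F.presheaf.stalkCongr (.of_eq hz.symm) ≪≫ asIso (m.stalkMap z')).commRingCatIsoToRingEquiv⟩

/-- Points of the fibre `f.fiber y` map to `y` under `f` (Mathlib `Scheme.Hom.range_fiberι`). [folklore] -/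
@[simp]
lemma apply_fiberι (f : X ⟶ Y) (y : Y) (z : ↥(f.fiber y)) : f (f.fiberι y z) = y := by
  have : f.fiberι y z ∈ f ⁻¹' {y} := by rw [← Scheme.Hom.range_fiberι]; exact ⟨z, rfl⟩
  simpa using this

end Tools

/-! ### The affine case -/

section Affine

variable (R S : Type u) [CommRing R] [CommRing S] [Algebra R S] (p : PrimeSpectrum R)

/-- Under Mathlib's `Spec.fiberToSpecResidueFieldIso` (`(Spec S)_𝔭 ≅ Spec (κ(𝔭) ⊗_R S)`), the
embedding of the fibre into `Spec S` is `Spec` of `s ↦ 1 ⊗ s` (the object component of the arrow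
isomorphism is written with its source and target pinned, `(Spec S)_𝔭 ⟶ Spec (κ(𝔭) ⊗_R S)`). [folklore] -/
lemma fiberToSpecResidueFieldIso_left_includeRight :
    Iso.hom (X := Scheme.Hom.fiber (Spec.map (CommRingCat.ofHom (algebraMap R S))) p)
        (Y := Spec (.of (p.asIdeal.Fiber S)))
        (Arrow.leftFunc.mapIso (Spec.fiberToSpecResidueFieldIso R S p)) ≫
      Spec.map (CommRingCat.ofHom (Algebra.TensorProduct.includeRight (R := R)
        (A := p.asIdeal.ResidueField) (B := S)).toRingHom) =
      Scheme.Hom.fiberι (Spec.map (CommRingCat.ofHom (algebraMap R S))) p := by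
  simp [Spec.fiberToSpecResidueFieldIso, Scheme.Hom.fiberι, Scheme.Hom.fiber, pullback.lift_snd]

variable {S} in
/-- Transport of `S_𝔯 ⧸ I S_𝔯` along an equality of prime ideals `𝔯 = 𝔯'`. [folklore] -/
lemma nonempty_locQuot_ringEquiv_of_eq {r r' : Ideal S} [r.IsPrime] [r'.IsPrime] (h : r = r')
    (I : Ideal S) :
    Nonempty ((Localization.AtPrime r ⧸ I.map (algebraMap S (Localization.AtPrime r))) ≃+*
      (Localization.AtPrime r' ⧸ I.map (algebraMap S (Localization.AtPrime r')))) := by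
  subst h
  exact ⟨RingEquiv.refl _⟩

/-- For `𝔮 ⊆ S` over `𝔭 ⊆ R`, the extension of `𝔪_{R_𝔭}` along `R_𝔭 → S_𝔮` is `𝔭 S_𝔮`. [folklore] -/
lemma map_localRingHom_maximalIdeal (q : PrimeSpectrum S)
    (h : p.asIdeal = q.asIdeal.comap (algebraMap R S)) :
    (maximalIdeal (Localization.AtPrime p.asIdeal)).map
        (Localization.localRingHom p.asIdeal q.asIdeal (algebraMap R S) h) =
      (p.asIdeal.map (algebraMap R S)).map (algebraMap S (Localization.AtPrime q.asIdeal)) := by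
  rw [← Localization.AtPrime.map_eq_maximalIdeal, Ideal.map_map, Ideal.map_map]
  congr 1
  ext a
  simp [Localization.localRingHom_to_map]

/-- **Affine case.** For `Spec S ⟶ Spec R` and a point `z` of the fibre over `𝔭` lying over the
prime `𝔮 = x` of `S`: `𝒪_{(Spec S)_𝔭, z} ≅ (κ(𝔭) ⊗_R S)_z ≅ S_𝔮 / 𝔭 S_𝔮 ≅ 𝒪_{Spec S, x} / 𝔪_𝔭 𝒪_{Spec S, x}`
(Mathlib `Ideal.Fiber.algEquivAux₂` for the middle step). [folklore] -/
theorem nonempty_stalkFiber_ringEquiv_Spec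
    (z : ↥(Scheme.Hom.fiber (Spec.map (CommRingCat.ofHom (algebraMap R S))) p)) :
    Nonempty (↑((Scheme.Hom.fiber (Spec.map (CommRingCat.ofHom (algebraMap R S))) p).presheaf.stalk z)
      ≃+* (↑((Spec (.of S)).presheaf.stalk
              (Scheme.Hom.fiberι (Spec.map (CommRingCat.ofHom (algebraMap R S))) p z)) ⧸
            (maximalIdeal ↑((Spec (.of R)).presheaf.stalk ((Spec.map (CommRingCat.ofHom (algebraMap R S)))
              (Scheme.Hom.fiberι (Spec.map (CommRingCat.ofHom (algebraMap R S))) p z)))).map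
            ((Spec.map (CommRingCat.ofHom (algebraMap R S))).stalkMap
              (Scheme.Hom.fiberι (Spec.map (CommRingCat.ofHom (algebraMap R S))) p z)).hom)) := by
  have hx : Spec.map (CommRingCat.ofHom (algebraMap R S))
      (Scheme.Hom.fiberι (Spec.map (CommRingCat.ofHom (algebraMap R S))) p z) = p := apply_fiberι _ _ _
  generalize hx' : Scheme.Hom.fiberι (Spec.map (CommRingCat.ofHom (algebraMap R S))) p z = x
  rw [hx'] at hx
  set Q : PrimeSpectrum (p.asIdeal.Fiber S) :=
    (Arrow.leftFunc.mapIso (Spec.fiberToSpecResidueFieldIso R S p)).hom z with hQ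
  -- 1. stalk of the fibre ≃ stalk of `Spec (κ(𝔭) ⊗ S)` at `Q`
  obtain ⟨e1⟩ := nonempty_stalk_ringEquiv_of_isIso_stalkMap
    (Arrow.leftFunc.mapIso (Spec.fiberToSpecResidueFieldIso R S p)).hom z Q rfl
  -- 2. ≃ the localisation `(κ(𝔭) ⊗ S)_Q`
  let e2 : ↑((Spec (.of (p.asIdeal.Fiber S))).presheaf.stalk Q) ≃+*
      Localization.AtPrime Q.asIdeal :=
    (Spec.stalkIso (.of (p.asIdeal.Fiber S)) Q).commRingCatIsoToRingEquiv
  -- 3. ≃ `S_𝔯 ⧸ 𝔭 S_𝔯`, `𝔯 = Q ∩ S`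
  let r : Ideal S := Q.asIdeal.comap Algebra.TensorProduct.includeRight
  let e3 : Localization.AtPrime Q.asIdeal ≃+*
      Localization.AtPrime r ⧸ (p.asIdeal.map (algebraMap R S)).map
        (algebraMap S (Localization.AtPrime r)) :=
    (Ideal.Fiber.algEquivAux₂ p.asIdeal Q.asIdeal).toRingEquiv
  -- 4. `𝔯 = x`
  have h1 : PrimeSpectrum.comap (Algebra.TensorProduct.includeRight (R := R)
      (A := p.asIdeal.ResidueField) (B := S)).toRingHom Q = x := by
    have := congr($(fiberToSpecResidueFieldIso_left_includeRight R S p) z)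
    simp only [Scheme.Hom.comp_apply, hx', Spec.map_apply, CommRingCat.hom_ofHom] at this
    exact this
  have hr : r = x.asIdeal :=
    calc r = (PrimeSpectrum.comap (Algebra.TensorProduct.includeRight (R := R)
        (A := p.asIdeal.ResidueField) (B := S)).toRingHom Q).asIdeal := rfl
      _ = x.asIdeal := by rw [h1]
  obtain ⟨e4⟩ := nonempty_locQuot_ringEquiv_of_eq (S := S) hr (p.asIdeal.map (algebraMap R S))
  -- 5. `𝔭 S_x` is `𝔪_𝔭 S_x` for the local homomorphism `R_𝔭 → S_x`
  let e5 : (Localization.AtPrime x.asIdeal ⧸ (p.asIdeal.map (algebraMap R S)).map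
        (algebraMap S (Localization.AtPrime x.asIdeal))) ≃+*
      (Localization.AtPrime x.asIdeal ⧸
        (maximalIdeal (Localization.AtPrime
          ((Spec.map (CommRingCat.ofHom (algebraMap R S))) x).asIdeal)).map
          (CommRingCat.ofHom (Localization.localRingHom
            ((Spec.map (CommRingCat.ofHom (algebraMap R S))) x).asIdeal x.asIdeal
            (algebraMap R S) rfl)).hom) :=
    Ideal.quotEquivOfEq (by
      rw [← hx]
      exact (map_localRingHom_maximalIdeal R S ((Spec.map (CommRingCat.ofHom (algebraMap R S))) x)
        x rfl).symm)
  -- 6. `R_𝔭 → S_x` is the stalk map of `Spec S ⟶ Spec R` at `x`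
  obtain ⟨e6⟩ := nonempty_fiberQuot_ringEquiv_of_arrowIso
    (Scheme.arrowStalkMapSpecIso (CommRingCat.ofHom (algebraMap R S)) x)
  exact ⟨((((e1.symm.trans e2).trans e3).trans e4).trans e5).trans e6.symm⟩

/-- The affine case, for a morphism `φ : R ⟶ S` in `CommRingCat`. [folklore] -/
theorem nonempty_stalkFiber_ringEquiv_SpecMap {R S : CommRingCat.{u}} (φ : R ⟶ S)
    (p : ↥(Spec R)) (z : ↥((Spec.map φ).fiber p)) :
    Nonempty (↑(((Spec.map φ).fiber p).presheaf.stalk z) ≃+*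
      (↑((Spec S).presheaf.stalk ((Spec.map φ).fiberι p z)) ⧸
        (maximalIdeal ↑((Spec R).presheaf.stalk ((Spec.map φ) ((Spec.map φ).fiberι p z)))).map
          ((Spec.map φ).stalkMap ((Spec.map φ).fiberι p z)).hom)) := by
  letI := φ.hom.toAlgebra
  exact nonempty_stalkFiber_ringEquiv_Spec R S p z

end Affine

/-! ### Reduction to the affine case -/

section Reduction

variable {X Y : Scheme.{u}} (f : X ⟶ Y)

/-- Reduction along an open immersion `j : U ⟶ X` into the source: if the statement holds for
`j ≫ f` at every point of its fibre over `y`, then it holds for `f` at every point `z` of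
`f.fiber y` lying over the image of `j`. The induced morphism of fibres
`(j ≫ f).fiber y ⟶ f.fiber y` (base change of `j`) is an open immersion, hence induces
isomorphisms on stalks, and `(j ≫ f)^♯_u = j^♯_u ∘ f^♯_{j u}` with `j^♯_u` an isomorphism. [folklore] -/
theorem nonempty_stalkFiber_ringEquiv_of_comp {U : Scheme.{u}} (j : U ⟶ X) [IsOpenImmersion j]
    (y : Y) (z : ↥(f.fiber y)) (hz : f.fiberι y z ∈ Set.range j)
    (h : ∀ z' : ↥((j ≫ f).fiber y), Nonempty (↑(((j ≫ f).fiber y).presheaf.stalk z') ≃+*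
      (↑(U.presheaf.stalk ((j ≫ f).fiberι y z')) ⧸
        (maximalIdeal ↑(Y.presheaf.stalk ((j ≫ f) ((j ≫ f).fiberι y z')))).map
          ((j ≫ f).stalkMap ((j ≫ f).fiberι y z')).hom))) :
    Nonempty (↑((f.fiber y).presheaf.stalk z) ≃+*
      (↑(X.presheaf.stalk (f.fiberι y z)) ⧸
        (maximalIdeal ↑(Y.presheaf.stalk (f (f.fiberι y z)))).map (f.stalkMap (f.fiberι y z)).hom)) := by
  -- the induced open immersion of fibres `m : (j ≫ f).fiber y ⟶ f.fiber y`
  obtain ⟨m, hm, hmo⟩ : ∃ m : (j ≫ f).fiber y ⟶ f.fiber y,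
      m ≫ f.fiberι y = (j ≫ f).fiberι y ≫ j ∧ IsOpenImmersion m :=
    ⟨pullback.map (j ≫ f) (Y.fromSpecResidueField y) f (Y.fromSpecResidueField y) j (𝟙 _) (𝟙 _)
        ((Category.comp_id _).trans rfl) ((Category.comp_id _).trans (Category.id_comp _).symm),
      pullback.lift_fst _ _ _,
      MorphismProperty.pullbackMap (P := @IsOpenImmersion) ‹_› inferInstance rfl
        (Category.id_comp _).symm⟩
  -- `z` comes from a point `z'` of `(j ≫ f).fiber y`
  obtain ⟨z', rfl⟩ : ∃ z', m z' = z := by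
    obtain ⟨u, hu⟩ := hz
    obtain ⟨z', h1, -⟩ := Scheme.Pullback.exists_preimage_pullback (f := j ≫ f)
      (g := Y.fromSpecResidueField y) u (f.fiberToSpecResidueField y z)
      (by rw [Scheme.Hom.comp_apply, hu, ← Scheme.Hom.comp_apply, Scheme.Hom.fiber_fac,
            Scheme.Hom.comp_apply])
    refine ⟨z', (f.fiberι y).isEmbedding.injective ?_⟩
    rw [← Scheme.Hom.comp_apply, hm, Scheme.Hom.comp_apply, ← hu]
    exact congrArg j h1
  obtain ⟨e⟩ := h z'
  have hpt : f.fiberι y (m z') = j ((j ≫ f).fiberι y z') := by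
    rw [← Scheme.Hom.comp_apply, hm, Scheme.Hom.comp_apply]
  rw [hpt]
  obtain ⟨e1⟩ := nonempty_stalk_ringEquiv_of_isIso_stalkMap m z' _ rfl
  obtain ⟨e2⟩ := nonempty_fiberQuot_ringEquiv_of_arrowIso
    (A := Y.presheaf.stalk (f (j ((j ≫ f).fiberι y z'))))
    (A' := Y.presheaf.stalk ((j ≫ f) ((j ≫ f).fiberι y z')))
    (φ := f.stalkMap (j ((j ≫ f).fiberι y z'))) (φ' := (j ≫ f).stalkMap ((j ≫ f).fiberι y z'))
    (Arrow.isoMk' _ _ (Iso.refl _) (asIso (j.stalkMap _)) (by simp [Scheme.Hom.stalkMap_comp]))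
  exact ⟨e1.trans (e.trans e2.symm)⟩

variable {V : Scheme.{u}} (ι : V ⟶ Y) [IsOpenImmersion ι]

/-- Reduction along an open immersion `ι : V ⟶ Y` into the target: if the statement holds for
the base change `pullback.snd f ι : X ×_Y V ⟶ V` at every point of its fibre over `v`, then it
holds for `f` at every point of `f.fiber (ι v)`. The induced morphism of fibres
`(pullback.snd f ι).fiber v ⟶ f.fiber (ι v)` is an isomorphism (`κ(ι v) ≅ κ(v)`; Mathlib
`isPullback_fiberToSpecResidueField_of_isPullback`), and Mathlib `Scheme.stalkMapIsoOfIsPullback`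
compares the stalk maps of `f` and `pullback.snd f ι`. [folklore] -/
theorem nonempty_stalkFiber_ringEquiv_of_snd (v : V) (z : ↥(f.fiber (ι v)))
    (h : ∀ z' : ↥((pullback.snd f ι).fiber v),
      Nonempty (↑(((pullback.snd f ι).fiber v).presheaf.stalk z') ≃+*
        (↑((pullback f ι).presheaf.stalk ((pullback.snd f ι).fiberι v z')) ⧸
          (maximalIdeal ↑(V.presheaf.stalk ((pullback.snd f ι) ((pullback.snd f ι).fiberι v z')))).map
            ((pullback.snd f ι).stalkMap ((pullback.snd f ι).fiberι v z')).hom))) :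
    Nonempty (↑((f.fiber (ι v)).presheaf.stalk z) ≃+*
      (↑(X.presheaf.stalk (f.fiberι (ι v) z)) ⧸
        (maximalIdeal ↑(Y.presheaf.stalk (f (f.fiberι (ι v) z)))).map
          (f.stalkMap (f.fiberι (ι v) z)).hom)) := by
  -- the induced isomorphism of fibres `m : (pullback.snd f ι).fiber v ⟶ f.fiber (ι v)`
  obtain ⟨m, hm, hmi⟩ : ∃ m : (pullback.snd f ι).fiber v ⟶ f.fiber (ι v),
      m ≫ f.fiberι (ι v) = (pullback.snd f ι).fiberι v ≫ pullback.fst f ι ∧ IsIso m :=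
    ⟨pullback.map _ _ _ _ (pullback.fst f ι) (Spec.map (ι.residueFieldMap v)) ι
        (IsPullback.of_hasPullback f ι).w.symm (by simp),
      pullback.lift_fst _ _ _,
      (isPullback_fiberToSpecResidueField_of_isPullback (IsPullback.of_hasPullback f ι) v)
        |>.isIso_fst_of_isIso⟩
  obtain ⟨z', rfl⟩ : ∃ z', m z' = z :=
    ⟨inv m z, by rw [← Scheme.Hom.comp_apply, IsIso.inv_hom_id]; rfl⟩
  obtain ⟨e⟩ := h z'
  have hpt : f.fiberι (ι v) (m z') = pullback.fst f ι ((pullback.snd f ι).fiberι v z') := by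
    rw [← Scheme.Hom.comp_apply, hm, Scheme.Hom.comp_apply]
  rw [hpt]
  obtain ⟨e1⟩ := nonempty_stalk_ringEquiv_of_isIso_stalkMap m z' _ rfl
  obtain ⟨e2⟩ := nonempty_fiberQuot_ringEquiv_of_arrowIso
    (Scheme.stalkMapIsoOfIsPullback (IsPullback.of_hasPullback f ι)
      ((pullback.snd f ι).fiberι v z'))
  exact ⟨e1.trans (e.trans e2.symm)⟩

end Reduction

/-! ### The local ring of the fibre -/

/-- **Local rings of scheme-theoretic fibres.** For a morphism of schemes `f : X ⟶ Y`, a point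
`y ∈ Y` and a point `z` of the fibre `X_y = X ×_Y Spec κ(y)` lying over `x = f.fiberι y z ∈ X`,
`𝒪_{X_y, z} ≅ 𝒪_{X,x} / 𝔪_y 𝒪_{X,x}` (Liu: "`𝒪_{X_y,x} = 𝒪_{X,x}/𝔪_y𝒪_{X,x}`"), the quotient of `𝒪_{X,x}`
by the extension of `𝔪_y ⊆ 𝒪_{Y,y}` along `f^♯_x`. Proved by reduction to `X`, `Y` affine, where it
is `(κ(𝔭) ⊗_R S)_𝔮 ≅ S_𝔮 / 𝔭 S_𝔮`. [cite: Liu2002, Ch. 4, proof of Theorem 3.36] -/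
theorem nonempty_stalkFiber_ringEquiv {X Y : Scheme.{u}} (f : X ⟶ Y) (y : Y) (z : ↥(f.fiber y)) :
    Nonempty (↑((f.fiber y).presheaf.stalk z) ≃+*
      (↑(X.presheaf.stalk (f.fiberι y z)) ⧸
        (maximalIdeal ↑(Y.presheaf.stalk (f (f.fiberι y z)))).map (f.stalkMap (f.fiberι y z)).hom)) := by
  -- chart on `Y`
  obtain ⟨i, v, rfl⟩ := Y.affineCover.exists_eq y
  refine nonempty_stalkFiber_ringEquiv_of_snd f (Y.affineCover.f i) v z fun z ↦ ?_
  -- chart on `X ×_Y V`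
  generalize pullback.snd f (Y.affineCover.f i) = g at z ⊢
  obtain ⟨k, u, hu⟩ := (pullback f (Y.affineCover.f i)).affineCover.exists_eq (g.fiberι v z)
  refine nonempty_stalkFiber_ringEquiv_of_comp g
    ((pullback f (Y.affineCover.f i)).affineCover.f k) v z ⟨u, hu⟩ fun z ↦ ?_
  clear hu
  generalize (pullback f (Y.affineCover.f i)).affineCover.f k ≫ g = F at z ⊢
  -- affine case
  obtain ⟨φ, rfl⟩ := Spec.map_surjective F
  exact nonempty_stalkFiber_ringEquiv_SpecMap φ v z

/-- The local ring of the fibre `X_{f x}` at (the point corresponding to) `x` is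
`𝒪_{X,x} / 𝔪_{f x} 𝒪_{X,x}` (the case `z = f.asFiber x` of `nonempty_stalkFiber_ringEquiv`).
[cite: Liu2002, Ch. 4, proof of Theorem 3.36] -/
theorem nonempty_stalkFiber_ringEquiv_asFiber {X Y : Scheme.{u}} (f : X ⟶ Y) (x : X) :
    Nonempty (↑((f.fiber (f x)).presheaf.stalk (f.asFiber x)) ≃+*
      (↑(X.presheaf.stalk x) ⧸ (maximalIdeal ↑(Y.presheaf.stalk (f x))).map (f.stalkMap x).hom)) := by
  have h := nonempty_stalkFiber_ringEquiv f (f x) (f.asFiber x)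
  rwa [Scheme.Hom.fiberι_asFiber] at h

end Literature.AlgebraicGeometry.Motives
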